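import Summits.Ventures.PercRepro.ProfilePointedMovesBounds

/-!
# PercRepro — THE COLOOP LIMIT VANISHES AT A PARALLEL PAIR (THE `p ↔ e` SWAP IS AN INVOLUTION OF THE CAPTURED
FAMILY REVERSING `2 #X − N`), AND THE 2-COVERABILITY BOUND `#upBlocked X < #X`
(p10, gen 16; `proofs/P10-AVFULL.md` §24(i))

For a finite matroid `M` on `N = #E`, a point `p` with a PARALLEL PARTNER `e` (`ρ{p} = ρ{e} = ρ{p, e} = 1`, `e ≠ p`)
and the captured family `𝒦 = capSets M p`: every `X ∈ 𝒦` contains `e` (`mem_of_mem_capSets_parallel`: `E ∖ X` is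
independent, so it cannot contain the pair), and the swap `X ↦ ((E ∖ X) ∖ p) ∪ e` (`parSwap`) is an involution of `𝒦`
(`parSwap_mem_capSets`, `parSwap_parSwap`: parallel elements are interchangeable in every rank) with
`#(parSwap X) = N − #X`.  Hence `Σ_{X ∈ 𝒦} (2 #X − N) = 0` (`sum_capSets_signed_parallel`, by `Finset.sum_involution`)
and (C1′) holds AT EVERY PARALLEL PAIR, with equality (`capLimit_body_parallel`) — the regime complementary to the
`p`-girth regime of ProfilePointedMovesBounds (there `g_p ≥ N − ρ + 1`, here `g_p = 2`).
THE 2-COVERABILITY BOUND: a bi-independent partition `(X, E ∖ X)` of a flat `F` gives `#F ≤ 2 ρ(F)`, so for `X ∈ 𝒦`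
the elements of the `p`-side inside `cl X` form an independent subset of a flat of rank `#X` containing `p`, and
`#upBlocked X + 1 ≤ #X` (`card_upBlocked_lt_card`) — together with `#upBlocked X + ρ + 1 ≤ N` of
ProfilePointedMovesBounds, `#upBlocked X ≤ min(#X, N − ρ) − 1`.  Nothing here asserts (C1′), (★), (A1κ) or (CM).
-/

open scoped Matroid

namespace PercRepro.Cogirth

open Finset ThmH Skew

variable {α : Type} [DecidableEq α] {M : Matroid α} [M.Finite]

/-! ### The captured family at a parallel pair -/

/-- Every captured set contains the parallel partner `e` of `p`: otherwise `E ∖ X` would contain the dependent pair. -/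
theorem mem_of_mem_capSets_parallel {p e : α} (hp : p ∈ gr M) (he : e ∈ gr M) (hpe' : p ≠ e)
    (hpe : rk M {p, e} = 1) {X : Finset α} (hX : X ∈ capSets M p) : e ∈ X := by
  obtain ⟨⟨hXb, hpX⟩, -⟩ := mem_capSets.1 hX
  by_contra heX
  exact not_pair_subset_of_parallel' hpe' hpe (mem_biIndepAll.1 hXb).2.2
    (insert_subset (mem_sdiff.2 ⟨hp, hpX⟩) (singleton_subset_iff.2 (mem_sdiff.2 ⟨he, heX⟩)))

/-- The `p ↔ e` swap on `p`-avoiding sets: `X ↦ ((E ∖ X) ∖ p) ∪ e`. -/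
noncomputable def parSwap (M : Matroid α) [M.Finite] (p e : α) (X : Finset α) : Finset α :=
  insert e ((gr M \ X).erase p)

/-- `E ∖ ((E ∖ X) ∖ p) = X ∪ p` for `X ⊆ E ∖ p`. -/
theorem sdiff_sdiff_erase {p : α} (hp : p ∈ gr M) {X : Finset α} (hXg : X ⊆ gr M) (hpX : p ∉ X) :
    gr M \ (gr M \ X).erase p = insert p X := by
  ext z
  simp only [mem_sdiff, mem_erase, mem_insert, not_and, not_not]
  constructor
  · rintro ⟨hz, h⟩
    by_cases hzp : z = p
    · exact Or.inl hzp
    · exact Or.inr (h hzp hz)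
  · rintro (rfl | hz)
    · exact ⟨hp, fun h _ => absurd rfl h⟩
    · exact ⟨hXg hz, fun _ _ => hz⟩

/-- **THE SWAP PRESERVES THE CAPTURED FAMILY** at a parallel pair of non-loops. -/
theorem parSwap_mem_capSets {p e : α} (hp : p ∈ gr M) (he : e ∈ gr M) (hpe' : p ≠ e) (hp1 : rk M {p} = 1)
    (he1 : rk M {e} = 1) (hpe : rk M {p, e} = 1) {X : Finset α} (hX : X ∈ capSets M p) :
    parSwap M p e X ∈ capSets M p := by
  have heX : e ∈ X := mem_of_mem_capSets_parallel hp he hpe' hpe hX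
  obtain ⟨⟨hXb, hpX⟩, -⟩ := mem_capSets.1 hX
  obtain ⟨hXg, hXr, hXc⟩ := mem_biIndepAll.1 hXb
  have hpZ : p ∈ gr M \ X := mem_sdiff.2 ⟨hp, hpX⟩
  set Y := (gr M \ X).erase p with hYdef
  have hYg : Y ⊆ gr M := (erase_subset _ _).trans sdiff_subset
  have heY : e ∉ Y := fun h => (mem_sdiff.1 (mem_of_mem_erase h)).2 heX
  have hpY : p ∉ Y := notMem_erase p _
  have hZ : insert p Y = gr M \ X := insert_erase hpZ
  have hcomp : gr M \ insert e Y = insert p (X.erase e) := by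
    rw [sdiff_insert, hYdef, sdiff_sdiff_erase hp hXg hpX, erase_insert_of_ne hpe']
  unfold parSwap
  rw [← hYdef, mem_capSets, mem_biIndepAll]
  refine ⟨⟨⟨insert_subset he hYg, ?_, ?_⟩, ?_⟩, ?_⟩
  · rw [rk_insert_eq_of_parallel' he hp he1 hp1 (by rw [pair_comm]; exact hpe) hYg, hZ, hXc, ← hZ,
      card_insert_of_notMem hpY, card_insert_of_notMem heY]
  · rw [hcomp, card_insert_of_notMem (fun h => hpX (mem_of_mem_erase h)),
      rk_insert_eq_of_parallel' hp he hp1 he1 hpe ((erase_subset _ _).trans hXg), insert_erase heX, hXr,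
      card_erase_of_mem heX]
    have : 0 < X.card := card_pos.2 ⟨e, heX⟩
    omega
  · rw [mem_insert, not_or]
    exact ⟨hpe', hpY⟩
  · have h1 : p ∈ clF M ({e} : Finset α) := by
      rw [mem_clF_iff_rk_insert_eq hp (singleton_subset_iff.2 he)]
      rw [show insert p ({e} : Finset α) = {p, e} from rfl, hpe, he1]
    exact clF_mono_sub (singleton_subset_iff.2 (mem_insert_self e Y)) h1

/-- The swap is an involution on the captured family. -/
theorem parSwap_parSwap {p e : α} (hp : p ∈ gr M) (he : e ∈ gr M) (hpe' : p ≠ e) (hpe : rk M {p, e} = 1)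
    {X : Finset α} (hX : X ∈ capSets M p) : parSwap M p e (parSwap M p e X) = X := by
  have heX : e ∈ X := mem_of_mem_capSets_parallel hp he hpe' hpe hX
  obtain ⟨⟨hXb, hpX⟩, -⟩ := mem_capSets.1 hX
  have hXg : X ⊆ gr M := (mem_biIndepAll.1 hXb).1
  unfold parSwap
  rw [sdiff_insert, sdiff_sdiff_erase hp hXg hpX, erase_insert_of_ne hpe',
    erase_insert (fun h => hpX (mem_of_mem_erase h)), insert_erase heX]

/-- `#(parSwap X) + #X = N`. -/
theorem card_parSwap_add {p e : α} (hp : p ∈ gr M) (he : e ∈ gr M) (hpe' : p ≠ e) (hpe : rk M {p, e} = 1)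
    {X : Finset α} (hX : X ∈ capSets M p) : (parSwap M p e X).card + X.card = (gr M).card := by
  have heX : e ∈ X := mem_of_mem_capSets_parallel hp he hpe' hpe hX
  have heY : e ∉ (gr M \ X).erase p := fun h => (mem_sdiff.1 (mem_of_mem_erase h)).2 heX
  unfold parSwap
  rw [card_insert_of_notMem heY]
  have := card_pSide_add hp hX
  omega

/-- **THE COLOOP LIMIT VANISHES AT A PARALLEL PAIR**: `Σ_{X ∈ 𝒦} (2 #X − N) = 0`. -/
theorem sum_capSets_signed_parallel {p e : α} (hp : p ∈ gr M) (he : e ∈ gr M) (hpe' : p ≠ e)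
    (hp1 : rk M {p} = 1) (he1 : rk M {e} = 1) (hpe : rk M {p, e} = 1) :
    ∑ X ∈ capSets M p, (2 * (X.card : ℤ) - (gr M).card) = 0 := by
  apply sum_involution (fun X _ => parSwap M p e X)
  · intro X hX
    have h := card_parSwap_add hp he hpe' hpe hX
    have h' : ((parSwap M p e X).card : ℤ) + X.card = (gr M).card := by exact_mod_cast h
    linarith
  · intro X hX hne heq
    have h := card_parSwap_add hp he hpe' hpe hX
    rw [heq] at h
    apply hne
    have h' : (X.card : ℤ) + X.card = (gr M).card := by exact_mod_cast h
    linarith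
  · intro X hX
    exact parSwap_mem_capSets hp he hpe' hp1 he1 hpe hX
  · intro X hX
    exact parSwap_parSwap hp he hpe' hpe hX

/-- **(C1′) AT EVERY PARALLEL PAIR**, with equality: `N · Σ_k κ_k = 2 · Σ_k k · κ_k`. -/
theorem capLimit_body_parallel {p e : α} (hp : p ∈ gr M) (he : e ∈ gr M) (hpe' : p ≠ e)
    (hp1 : rk M {p} = 1) (he1 : rk M {e} = 1) (hpe : rk M {p, e} = 1) :
    (gr M).card * ∑ k ∈ range ((gr M).card + 1), capCount M k p =
      2 * ∑ k ∈ range ((gr M).card + 1), k * capCount M k p := by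
  have h0 := sum_capSets_signed_parallel hp he hpe' hp1 he1 hpe
  rw [sum_capSets_eq_levels] at h0
  have hsplit : ∑ k ∈ range ((gr M).card + 1), ((2 * (k : ℤ) - (gr M).card) * (capCount M k p : ℤ)) =
      2 * ∑ k ∈ range ((gr M).card + 1), ((k : ℤ) * (capCount M k p : ℤ)) -
        ((gr M).card : ℤ) * ∑ k ∈ range ((gr M).card + 1), (capCount M k p : ℤ) := by
    rw [mul_sum, mul_sum, ← sum_sub_distrib]
    apply sum_congr rfl
    intro k _
    ring
  rw [hsplit] at h0
  have : (((gr M).card * ∑ k ∈ range ((gr M).card + 1), capCount M k p : ℕ) : ℤ) =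
      ((2 * ∑ k ∈ range ((gr M).card + 1), k * capCount M k p : ℕ) : ℤ) := by
    push_cast
    linarith
  exact_mod_cast this

/-! ### The 2-coverability bound -/

/-- **THE 2-COVERABILITY BOUND**: for a captured `X`, `#upBlocked X + 1 ≤ #X` — the `p`-side elements inside `cl X`
form an independent subset of the rank-`#X` flat `cl X`, and `p` is one of them. -/
theorem card_upBlocked_lt_card {p : α} (hp : p ∈ gr M) {X : Finset α} (hX : X ∈ capSets M p) :
    (upBlocked M p X).card + 1 ≤ X.card := by
  obtain ⟨⟨hXb, hpX⟩, hpcl⟩ := mem_capSets.1 hX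
  set S := (gr M \ X) ∩ clF M X with hSdef
  have hpS : p ∈ S := mem_inter.2 ⟨mem_sdiff.2 ⟨hp, hpX⟩, hpcl⟩
  have hSind : rk M S = S.card :=
    rk_eq_card_of_subset_of_rk_eq_card inter_subset_left (mem_biIndepAll.1 hXb).2.2
  have hSle : rk M S ≤ X.card := by
    calc rk M S ≤ rk M (clF M X) := rk_mono' inter_subset_right
      _ = rk M X := rk_clF_eq_rk X
      _ = X.card := (mem_biIndepAll.1 hXb).2.1
  have hup : upBlocked M p X = S.erase p := by
    unfold upBlocked
    ext y
    simp only [hSdef, mem_filter, mem_erase, mem_inter]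
    tauto
  rw [hup, card_erase_of_mem hpS]
  have := card_pos.2 ⟨p, hpS⟩
  omega

end PercRepro.Cogirth
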